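import Literature.MathematicalPhysics.QuantumLattice.StabilityCoreBProofs
import HarnessLib

/-!
# Adapters for the spectral-flow core of `michalakis_zwolak` (term-wise input, `∀ p` bounds)

Top-down layer (seat B) of the formalisation of the Michalakis–Zwolak stability theorem
(hubbard.S19, `Literature.MathematicalPhysics.QuantumLattice.michalakis_zwolak`). The theorem
`michalakis_zwolak_of_coreA` (`StabilityCoreBProofs`) asks the analytic side for the rotated
perturbation `U⋆ (H₀ + sεV) U − H₀` grouped by Bravais centre `u`, with one fast-decaying profile
`φ`. The Lieb–Robinson / spectral-flow layers naturally deliver something slightly different: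
pieces attached to the *terms* of the Hamiltonian (regions `Z` of `Φ L` and of `V L`, or any
finite index set of "groups"), each group commuting with `P₀`, with polynomial bounds
`‖·‖ ≤ |ε| B_p/(ℓ+1)^p` for every `p` (the form of `exists_norm_smoothing_sub_twirl_le_div_pow`,
MZ13 Lemma 1 (iv): "for a rapidly decaying function"). This file bridges the two:

* `hasFastDecay_iInf_pow_bound` — the envelope `φ_B(i) = ⨅_p max(B_p, 0)/(i+1)^p` of a family of
  power bounds is non-negative and fast decaying, and dominates anything bounded by all
  `max(B_p,0)/(i+1)^p` (`le_iInf_pow_bound`);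
* `regroup_by_centre` — pieces `Y g ℓ` indexed by groups `g` with centres `c g` (multiplicity
  `≤ N` per centre) regroup into `X u i = Σ_{c g = u} Y g i` with the properties required by
  `michalakis_zwolak_of_coreA` and profile `N ψ`;
* `michalakis_zwolak_of_termwise_core` — the named fact from the **term-wise core**: `L_A`, `N`,
  `B : ℕ → ℝ` such that for `|ε| ≤ 1`, `L ≥ L_A`, `s ∈ [0,1]` with the `γ/2`-gap on `[0, s]` there
  are a unitary `U`, a finite type of groups `G` with centres `c : G → (ℤ/Lℤ)^d` of multiplicity
  `≤ N`, and pieces `Y g ℓ` (`ℓ ≤ L`) — Hermitian, supported in `cellBall (c g) ℓ`, each group's sum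
  commuting with `P₀`, `‖Y g ℓ‖ ≤ |ε| B_p/(ℓ+1)^p` for all `p` — with
  `U⋆ (H₀ + sεV) U = H₀ + Σ_g Σ_ℓ Y g ℓ`.

No definitions, no named facts (theorems only).
-/

noncomputable section

open Matrix Finset Module Filter Asymptotics
open scoped InnerProductSpace ComplexOrder Matrix.Norms.L2Operator Topology

namespace Literature.MathematicalPhysics.QuantumLattice

open Literature.Probability.LatticeModels

/-! ### The envelope of a family of power bounds -/

section Envelope

/-- The family `p ↦ max(B_p,0)/(i+1)^p` is bounded below (by `0`). [folklore] -/
theorem bddBelow_range_pow_bound (B : ℕ → ℝ) (i : ℕ) :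
    BddBelow (Set.range fun p : ℕ => max (B p) 0 / ((i : ℝ) + 1) ^ p) :=
  ⟨0, by rintro _ ⟨p, rfl⟩; positivity⟩

/-- The envelope `⨅_p max(B_p,0)/(i+1)^p` is non-negative. [folklore] -/
theorem iInf_pow_bound_nonneg (B : ℕ → ℝ) (i : ℕ) :
    0 ≤ ⨅ p : ℕ, max (B p) 0 / ((i : ℝ) + 1) ^ p :=
  le_ciInf fun p => by positivity

/-- The envelope lies below each bound. [folklore] -/
theorem iInf_pow_bound_le (B : ℕ → ℝ) (i p : ℕ) :
    (⨅ p : ℕ, max (B p) 0 / ((i : ℝ) + 1) ^ p) ≤ max (B p) 0 / ((i : ℝ) + 1) ^ p :=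
  ciInf_le (bddBelow_range_pow_bound B i) p

/-- Anything below all the bounds is below the envelope. [folklore] -/
theorem le_iInf_pow_bound {B : ℕ → ℝ} {i : ℕ} {a : ℝ}
    (h : ∀ p : ℕ, a ≤ max (B p) 0 / ((i : ℝ) + 1) ^ p) :
    a ≤ ⨅ p : ℕ, max (B p) 0 / ((i : ℝ) + 1) ^ p :=
  le_ciInf h

/-- **The envelope of a family of power bounds is fast decaying**: for every `p`,
`i^p φ_B(i) ≤ (i+1)^p · max(B_{p+1},0)/(i+1)^{p+1} = max(B_{p+1},0)/(i+1) → 0`. This turns the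
"`∀ p ∃ B_p`" bounds of the Lieb–Robinson layers into the single `HasFastDecay` profile of
`michalakis_zwolak_of_coreA`. [folklore] -/
theorem hasFastDecay_iInf_pow_bound (B : ℕ → ℝ) :
    HasFastDecay fun i : ℕ => ⨅ p : ℕ, max (B p) 0 / ((i : ℝ) + 1) ^ p := by
  intro p
  have hup : Tendsto (fun i : ℕ => max (B (p + 1)) 0 * (1 / ((i : ℝ) + 1))) atTop (𝓝 0) := by
    have h := (tendsto_one_div_add_atTop_nhds_zero_nat).const_mul (max (B (p + 1)) 0)
    rw [mul_zero] at h
    exact h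
  refine tendsto_of_tendsto_of_tendsto_of_le_of_le tendsto_const_nhds hup (fun i => ?_) (fun i => ?_)
  · exact mul_nonneg (by positivity) (iInf_pow_bound_nonneg B i)
  · have hi1 : (0 : ℝ) < (i : ℝ) + 1 := by positivity
    have h1 : ((i : ℝ)) ^ p ≤ ((i : ℝ) + 1) ^ p := pow_le_pow_left₀ (Nat.cast_nonneg _) (by linarith) p
    have h2 := iInf_pow_bound_le B i (p + 1)
    calc ((i : ℝ)) ^ p * (⨅ p : ℕ, max (B p) 0 / ((i : ℝ) + 1) ^ p)
        ≤ ((i : ℝ) + 1) ^ p * (max (B (p + 1)) 0 / ((i : ℝ) + 1) ^ (p + 1)) :=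
          mul_le_mul h1 h2 (iInf_pow_bound_nonneg B i) (by positivity)
      _ = max (B (p + 1)) 0 * (1 / ((i : ℝ) + 1)) := by rw [pow_succ]; field_simp

end Envelope

/-! ### Regrouping term-wise pieces by Bravais centre -/

section Regroup

variable {d L : ℕ} [NeZero L] {κ : Type*} [Fintype κ] [DecidableEq κ] {q : ℕ}

/-- **Regrouping by centre.** Pieces `Y g ℓ` indexed by a finite type of groups `g` with centres
`c g ∈ (ℤ/Lℤ)^d`, supported in `cellBall (c g) ℓ`, Hermitian, with each group's sum over `ℓ ≤ L`
commuting with `P₀` and `‖Y g ℓ‖ ≤ J ψ ℓ`, and at most `N` groups per centre, regroup into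
`X u ℓ = Σ_{c g = u} Y g ℓ` with the same total sum, supports `cellBall u ℓ`, Hermitian, per-centre
commutation, and `‖X u ℓ‖ ≤ J (N ψ ℓ)`. [folklore] -/
theorem regroup_by_centre {G : Type*} [Fintype G] (c : G → TorusSite d L)
    (Y : G → ℕ → Op (TorusSite d L × κ) q) (P₀ : Op (TorusSite d L × κ) q)
    (hYs : ∀ g ℓ, IsSupportedOn (Y g ℓ) (cellBall (c g) ℓ)) (hYh : ∀ g ℓ, (Y g ℓ).IsHermitian)
    (hYc : ∀ g, Commute (∑ ℓ ∈ range (L + 1), Y g ℓ) P₀) {J : ℝ} (hJ : 0 ≤ J) {ψ : ℕ → ℝ}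
    (hYn : ∀ g ℓ, ‖Y g ℓ‖ ≤ J * ψ ℓ) {N : ℕ} (hN : ∀ u, (univ.filter fun g => c g = u).card ≤ N)
    (hψ0 : ∀ ℓ, 0 ≤ ψ ℓ) :
    (∑ g, ∑ ℓ ∈ range (L + 1), Y g ℓ =
        ∑ u : TorusSite d L, ∑ ℓ ∈ range (L + 1), ∑ g ∈ univ.filter (fun g => c g = u), Y g ℓ) ∧
      (∀ u ℓ, IsSupportedOn (∑ g ∈ univ.filter (fun g => c g = u), Y g ℓ) (cellBall u ℓ)) ∧
      (∀ u ℓ, (∑ g ∈ univ.filter (fun g => c g = u), Y g ℓ).IsHermitian) ∧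
      (∀ u, Commute (∑ ℓ ∈ range (L + 1), ∑ g ∈ univ.filter (fun g => c g = u), Y g ℓ) P₀) ∧
      (∀ u ℓ, ‖∑ g ∈ univ.filter (fun g => c g = u), Y g ℓ‖ ≤ J * ((N : ℝ) * ψ ℓ)) := by
  classical
  refine ⟨?_, ?_, ?_, ?_, ?_⟩
  · -- total sum: sum over the fibres of `c`
    rw [← Finset.sum_fiberwise_of_maps_to (g := c) (s := univ) (t := univ) (fun g _ => mem_univ _)]
    refine sum_congr rfl fun u _ => ?_
    rw [Finset.sum_comm]
  · intro u ℓ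
    refine IsSupportedOn.sum _ fun g hg => ?_
    have hcg : c g = u := (mem_filter.mp hg).2
    rw [← hcg]
    exact hYs g ℓ
  · intro u ℓ
    rw [IsHermitian, conjTranspose_sum]
    exact sum_congr rfl fun g _ => (hYh g ℓ).eq
  · intro u
    rw [Finset.sum_comm]
    exact Commute.sum_left _ _ _ fun g _ => hYc g
  · intro u ℓ
    calc ‖∑ g ∈ univ.filter (fun g => c g = u), Y g ℓ‖
        ≤ ∑ g ∈ univ.filter (fun g => c g = u), ‖Y g ℓ‖ := norm_sum_le _ _
      _ ≤ ∑ _g ∈ univ.filter (fun g => c g = u), J * ψ ℓ := sum_le_sum fun g _ => hYn g ℓ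
      _ = ((univ.filter fun g => c g = u).card : ℝ) * (J * ψ ℓ) := by
          rw [sum_const, nsmul_eq_mul]
      _ ≤ (N : ℝ) * (J * ψ ℓ) :=
          mul_le_mul_of_nonneg_right (by exact_mod_cast hN u) (mul_nonneg hJ (hψ0 ℓ))
      _ = J * ((N : ℝ) * ψ ℓ) := by ring

end Regroup

/-! ### The named fact from the term-wise core -/

section Termwise

universe u

variable (d q : ℕ) {κ : Type u} [Fintype κ] [DecidableEq κ]

/-- **`michalakis_zwolak` from the term-wise spectral-flow core.** Same as
`michalakis_zwolak_of_coreA`, but the analytic side may deliver the rotated perturbation grouped by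
an arbitrary finite type of "groups" (e.g. the terms `Φ L Z`, `V L Z`) with Bravais centres of
bounded multiplicity, and with power bounds `‖Y g ℓ‖ ≤ |ε| B_p/(ℓ+1)^p` for every `p` in place of
a single fast-decaying profile (`hasFastDecay_iInf_pow_bound`, `regroup_by_centre`).
[cite: MichalakisZwolakCMP2013, Thm. 1, Lemmas 1–2, Prop. 1 (arXiv:1109.1588 pp. 6–12)] -/
theorem michalakis_zwolak_of_termwise_core
    (hT : ∀ (Φ : (L : ℕ) → Interaction (TorusSite d L × κ) q) (m : ℕ → ℕ) (γ : ℝ) (r₀ : ℕ)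
      (Δ γloc : ℕ → ℝ),
      (∀ (L : ℕ) [NeZero L], IsProjectorInteraction (Φ L) ∧ (Φ L).IsLocal) →
      (∀ (L : ℕ) [NeZero L], IsFrustrationFree (Φ L) univ) →
      (∀ (L : ℕ) [NeZero L] (X : Finset (TorusSite d L × κ)), r₀ < torusDiam X → Φ L X = 0) →
      (0 < γ ∧ ∀ (L : ℕ) [NeZero L], (localHamiltonian (Φ L) univ).HasClusterGap (m L) 0 γ) →
      HasUniformLTQO Φ Δ → HasFastDecay Δ → HasUniformLocalGap Φ γloc →
      (∃ c : ℝ, ∃ p : ℕ, 0 < c ∧ ∀ ℓ : ℕ, c / ((ℓ : ℝ) + 1) ^ p ≤ γloc ℓ) →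
      ∀ (r : ℕ) (V : (L : ℕ) → Interaction (TorusSite d L × κ) q),
        (∀ (L : ℕ) [NeZero L], (V L).IsLocal ∧
          (∀ X, r < torusDiam X → V L X = 0) ∧ ∀ X, ‖V L X‖ ≤ 1) →
        ∃ L_A : ℕ, ∃ N : ℕ, ∃ B : ℕ → ℝ,
          ∀ ε : ℝ, |ε| ≤ 1 → ∀ (L : ℕ) [NeZero L], L_A ≤ L → ∀ s ∈ Set.Icc (0 : ℝ) 1,
            (∀ t ∈ Set.Icc (0 : ℝ) s, ∃ ω : ℝ, ω ≤ γ ∧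
              (localHamiltonian (Φ L) univ +
                (t : ℂ) • ((ε : ℂ) • localHamiltonian (V L) univ)).HasClusterGap (m L) ω (γ / 2)) →
            ∃ (U : Op (TorusSite d L × κ) q) (G : Type u) (_ : Fintype G) (c : G → TorusSite d L)
              (Y : G → ℕ → Op (TorusSite d L × κ) q),
              U ∈ unitary (Op (TorusSite d L × κ) q) ∧
              star U * (localHamiltonian (Φ L) univ +
                (s : ℂ) • ((ε : ℂ) • localHamiltonian (V L) univ)) * U =
                localHamiltonian (Φ L) univ + ∑ g, ∑ ℓ ∈ range (L + 1), Y g ℓ ∧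
              (∀ g ℓ, IsSupportedOn (Y g ℓ) (cellBall (c g) ℓ)) ∧
              (∀ g ℓ, (Y g ℓ).IsHermitian) ∧
              (∀ g, Commute (∑ ℓ ∈ range (L + 1), Y g ℓ) (localGroundProj (Φ L) univ)) ∧
              (∀ g ℓ (p : ℕ), ‖Y g ℓ‖ ≤ |ε| * (B p / ((ℓ : ℝ) + 1) ^ p)) ∧
              (∀ u, (univ.filter fun g => c g = u).card ≤ N)) :
    michalakis_zwolak (κ := κ) d q := by
  refine michalakis_zwolak_of_coreA d q ?_
  intro Φ m γ r₀ Δ γloc hproj hff hrange hgap hltqo hΔ hloc hγloc r V hV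
  obtain ⟨L_A, N, B, hcore⟩ := hT Φ m γ r₀ Δ γloc hproj hff hrange hgap hltqo hΔ hloc hγloc r V hV
  -- the profile
  set ψ : ℕ → ℝ := fun i => ⨅ p : ℕ, max (B p) 0 / ((i : ℝ) + 1) ^ p with hψdef
  have hψ : HasFastDecay ψ := hasFastDecay_iInf_pow_bound B
  have hψ0 : ∀ i, 0 ≤ ψ i := iInf_pow_bound_nonneg B
  refine ⟨L_A, fun i => (N : ℝ) * ψ i, hψ.const_mul (N : ℝ),
    fun i => mul_nonneg (Nat.cast_nonneg N) (hψ0 i), ?_⟩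
  intro ε hε L _ hL s hs hprev
  obtain ⟨U, G, instG, c, Y, hU, hdec, hYs, hYh, hYc, hYn, hN⟩ := hcore ε hε L hL s hs hprev
  have hYn' : ∀ g ℓ, ‖Y g ℓ‖ ≤ |ε| * ψ ℓ := by
    intro g ℓ
    by_cases hε0 : ε = 0
    · -- `ε = 0`: the pieces vanish
      have h := hYn g ℓ 0
      simp only [hε0, abs_zero, zero_mul] at h ⊢
      exact h
    · have hεpos : 0 < |ε| := abs_pos.mpr hε0
      rw [← div_le_iff₀' hεpos]
      refine le_iInf_pow_bound fun p => ?_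
      rw [div_le_iff₀' hεpos]
      refine (hYn g ℓ p).trans (mul_le_mul_of_nonneg_left ?_ hεpos.le)
      exact div_le_div_of_nonneg_right (le_max_left _ _) (by positivity)
  obtain ⟨hsum, hXs, hXh, hXc, hXn⟩ := regroup_by_centre c Y (localGroundProj (Φ L) univ) hYs hYh
    hYc (abs_nonneg ε) hYn' hN hψ0
  refine ⟨U, fun u ℓ => ∑ g ∈ univ.filter (fun g => c g = u), Y g ℓ, hU, ?_, hXs, hXh, hXc, hXn⟩
  rw [hdec, hsum]

end Termwise

end Literature.MathematicalPhysics.QuantumLattice
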